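import Summits.HodgeConjecture.CorCM.IrreducibleOddWeightsShadowIdealsStabilizerBalance
import HarnessLib

/-!
# Shadow ideals, IX: FAMILIES — `Hg(∏_i A_i) = ∏_i Hg(A_i)` iff no slot `j` carries an equivariant RELATION
# `Σ_i α_i(u_i) = 0`, `α_i : ℚ^{E_i} → ℚ^{E_j}`, `α_j(u_j) ≠ 0`; in coordinates: no invariant-kernel relation

COR-CM (cell `pub-hodgecm2`, binder seat `b16` gen 63, count-neutral claim SHADOW IDEALS, file S9 — abstract `G`-set level
and CM fields; theorems only, no definition, no named fact, no `sorry`).  NEW as stated, hence under `Summits/`.  HONEST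
FRAMING: finite-dimensional linear algebra about `dim MT(∏_i A_i)` for finitely many abelian varieties with complex
multiplication (arbitrary CM fields, arbitrary types), and the Hodge conjecture for the NAMED class of their products when
the criterion holds and the members are nondegenerate; `HC_CM` is neither used nor asserted.

The tree's evaluation criterion (`CMTypeRankEvaluationCriterion`): `U(Σ) = ⊕_i U(Φ_i)` iff in every IRREDUCIBLE
representation `V` the evaluation vectors `T_i(u_i)` of equivariant `T_i : ℚ^{E_i} → V` are independent.  File S7 removed
the quantifier over abstract `V` for PAIRS; the same device (an irreducible receiving `T_j ≠ 0` from `ℚ^{E_j}` embeds into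
`ℚ^{E_j}`, S2) does it for FAMILIES:

* §1 **`IrrOdd.forall_map_slotExt_le_iff_forall_not_exists_relation`**: additive **iff for every slot `j` there is NO
  family of `G`-equivariant `α_i : ℚ^{E_i} → ℚ^{E_j}` with `Σ_i α_i(u_1(Φ_i)) = 0` and `α_j(u_1(Φ_j)) ≠ 0`.**  Rank form
  **`IrrOdd.typeRank_sigmaType_add_card_eq_iff_forall_not_exists_relation`**; invariant-kernel form
  **`IrrOdd.typeRank_sigmaType_add_card_eq_iff_forall_not_exists_kernel_relation`** (`α_i ↔` a `G`-invariant kernel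
  `k_i : E_j × E_i → ℚ`, a function of the `G`-orbit of the pair).
* §2 CM fields: **`cmFamilyRank_add_card_eq_iff_forall_not_exists_kernel_relation`** — for ANY finite family of CM fields
  `K_i` and types `Φ_i`: `Hg(∏ A_i) = ∏ Hg(A_i)` (`cmFamilyRank Φ + |I| = Σ_i cmTypeRank Φ_i + 1`) **iff no slot `j` carries
  an `Aut(ℂ)`-invariant kernel relation `Σ_i Σ_{x_i} k_i(·, x_i) u_i(x_i) = 0` on `Hom(K_j, ℂ)` with the `j`-th term non-zero**
  (each `k_i` a function of the factor of `K_j ⊗_ℚ K_i` selected by the pair of embeddings); sufficient condition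
  **`cmFamilyRank_add_card_eq_of_pairwise_stabilizer_orbit_sums_eq_zero`** (file S8 for families: for all `i ≠ j`, `Φ_i`
  meets every `Aut(ℂ/x_j(K_j))`-orbit on `Hom(K_i, ℂ)` in half its points ⟹ `Hg(∏ A_i) = ∏ Hg(A_i)`; the tree's O2
  `…of_pairwise_kernel` asked balance along the finer orbits of `Aut(ℂ/L_j)`);
  **`isNondegenerateFamily_iff_forall_isNondegenerate_and_forall_not_exists_kernel_relation`**; and
  **`hodgeConjectureFor_prod_of_forall_not_exists_kernel_relation`** — the Hodge conjecture on every `∏_i A_i^{a_i}` for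
  NONDEGENERATE members satisfying the criterion, unconditionally (the family is then nondegenerate: tree
  `IsNondegenerateFamily.hodgeConjectureFor_prod`).

## References

* [Mai1989] L. Mai, *Lower bounds for the ranks of CM types*, J. Number Theory 32 (1989), §2 Prop. 1 (proof).
* [Gordon1999HodgeAVSurvey] B. B. Gordon, *A survey of the Hodge conjecture for abelian varieties*, §3 Theorem (Imai,
  Murty) with proof, 7.5–7.7, 10.10.
* [Serre1977] J.-P. Serre, *Linear Representations of Finite Groups*, GTM 42, §2.2 Prop. 4, §7 Ex. 7.2.
* [Deligne1982HodgeCycles] P. Deligne, *Hodge cycles on abelian varieties*, LNM 900 (1982), I Ex. 3.7.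
-/

set_option autoImplicit false

noncomputable section

open scoped BigOperators Classical

universe u v w

namespace Summit.HodgeConjecture.CorCM

namespace IrrOdd

open Literature.NumberTheory.ComplexMultiplication

variable {G : Type w} [Group G] {I : Type u} {E : I → Type v} [∀ i, MulAction G (E i)] [DecidableEq I] [Fintype I]
  [∀ i, Fintype (E i)]

/-! ### §1 The relation criterion for families -/

/-- **FAMILIES: additive iff no slot carries an equivariant relation.**  `U(Σ) = ⊕_i U(Φ_i)` (`Hg(∏ A_i) = ∏ Hg(A_i)`)
**iff** for every slot `j` there are NO `G`-equivariant `α_i : ℚ^{E_i} → ℚ^{E_j}` (`i ∈ I`) with `Σ_i α_i(u_1(Φ_i)) = 0` and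
`α_j(u_1(Φ_j)) ≠ 0`.  (⟹ the evaluation criterion in the permutation representation `ℚ^{E_j}`; ⟸ a relation in an
irreducible `V` with `T_j(u_j) ≠ 0` transfers into `ℚ^{E_j}` along an equivariant embedding `V ↪ ℚ^{E_j}`.)
[cite: Mai1989, §2 Prop. 1 (proof)] [cite: Serre1977, §2.2 Prop. 4] -/
theorem forall_map_slotExt_le_iff_forall_not_exists_relation (Φ : ∀ i, Set (E i)) :
    (∀ i, (antiSpan G (Φ i)).map (slotExt i) ≤ antiSpan G (sigmaType Φ)) ↔
      ∀ j : I, ¬ ∃ α : ∀ i, (E i → ℚ) →ₗ[ℚ] (E j → ℚ),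
        (∀ i (g : G) (f : E i → ℚ), α i (fun x => f (g⁻¹ • x)) = fun y => α i f (g⁻¹ • y)) ∧
        ∑ i, α i (antiVec (Φ i) (1 : G)) = 0 ∧ α j (antiVec (Φ j) (1 : G)) ≠ 0 := by
  classical
  constructor
  · rintro hadd j ⟨α, hα, hsum, hne⟩
    let π : Representation ℚ G (E j → ℚ) :=
      { toFun := fun g => LinearMap.funLeft ℚ ℚ fun x : E j => g⁻¹ • x
        map_one' := by ext f x; simp
        map_mul' := fun g h => by ext f x; simp [mul_smul] }
    exact hne (eval_eq_zero_of_forall_map_slotExt_le Φ hadd π α (fun i g f => hα i g f) hsum j)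
  · intro hno
    refine forall_map_slotExt_le_of_forall_irreducible Φ fun V _ _ _ π hπ T hT hsum => ?_
    by_contra hnot
    push Not at hnot
    obtain ⟨j, hj⟩ := hnot
    have hTj : T j ≠ 0 := fun h0 => hj (by rw [h0, LinearMap.zero_apply])
    obtain ⟨ι, hιinj, hι⟩ := exists_equivariant_injective_of_irreducible π hπ (T j) (hT j) hTj
    refine hno j ⟨fun i => ι ∘ₗ T i, fun i g f => ?_, ?_, ?_⟩
    · rw [LinearMap.comp_apply, LinearMap.comp_apply, hT i, hι]
    · simp only [LinearMap.comp_apply, ← map_sum, hsum, map_zero]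
    · rw [LinearMap.comp_apply]
      exact fun h0 => hj (hιinj (by rw [h0, map_zero]))

variable [Nonempty I] [∀ i, Nonempty (E i)]

/-- **Rank form**: `rank(Σ) + |I| = Σ_i rank(Φ_i) + 1` (`dim MT(∏A_i) − 1 = Σ_i (dim MT(A_i) − 1)`) iff no slot carries an
equivariant relation. [cite: Gordon1999HodgeAVSurvey, §3 Theorem (1) and 7.7] [cite: Mai1989, §2 Prop. 1 (proof)] -/
theorem typeRank_sigmaType_add_card_eq_iff_forall_not_exists_relation {ρ : G} {Φ : ∀ i, Set (E i)}
    (h : ∀ i, IsCMTypeWith ρ (Φ i)) :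
    typeRank G (sigmaType Φ) + Fintype.card I = (∑ i, typeRank G (Φ i)) + 1 ↔
      ∀ j : I, ¬ ∃ α : ∀ i, (E i → ℚ) →ₗ[ℚ] (E j → ℚ),
        (∀ i (g : G) (f : E i → ℚ), α i (fun x => f (g⁻¹ • x)) = fun y => α i f (g⁻¹ • y)) ∧
        ∑ i, α i (antiVec (Φ i) (1 : G)) = 0 ∧ α j (antiVec (Φ j) (1 : G)) ≠ 0 := by
  rw [← forall_map_slotExt_le_iff_typeRank_sigmaType_add_card_eq h]
  exact forall_map_slotExt_le_iff_forall_not_exists_relation Φ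

/-- **INVARIANT-KERNEL FORM for families**: additive iff no slot `j` carries `G`-invariant kernels
`k_i : E_j × E_i → ℚ` with `Σ_i Σ_{x_i} k_i(x_j, x_i) u_i(x_i) = 0` for all `x_j` and the `j`-th term not identically zero.
[cite: Gordon1999HodgeAVSurvey, §3 Theorem (proof) and 7.5–7.7] [cite: Serre1977, §7 Ex. 7.2] -/
theorem typeRank_sigmaType_add_card_eq_iff_forall_not_exists_kernel_relation {ρ : G} {Φ : ∀ i, Set (E i)}
    (h : ∀ i, IsCMTypeWith ρ (Φ i)) :
    typeRank G (sigmaType Φ) + Fintype.card I = (∑ i, typeRank G (Φ i)) + 1 ↔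
      ∀ j : I, ¬ ∃ k : ∀ i, E j → E i → ℚ,
        (∀ i (g : G) (y : E j) (x : E i), k i (g • y) (g • x) = k i y x) ∧
        (fun y => ∑ i, ∑ x, k i y x * antiVec (Φ i) (1 : G) x) = 0 ∧
        (fun y => ∑ x, k j y x * antiVec (Φ j) (1 : G) x) ≠ 0 := by
  classical
  rw [typeRank_sigmaType_add_card_eq_iff_forall_not_exists_relation h]
  refine forall_congr' fun j => not_congr ⟨?_, ?_⟩
  · rintro ⟨α, hα, hsum, hne⟩
    refine ⟨fun i y x => α i (Pi.single x 1) y, fun i g y x => kernel_invariant_of_equivariant (α i) (hα i) g y x,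
      ?_, ?_⟩
    · funext y
      have h1 := congrFun hsum y
      rw [Finset.sum_apply, Pi.zero_apply] at h1
      rw [Pi.zero_apply, ← h1]
      exact Finset.sum_congr rfl fun i _ => (apply_eq_sum_kernel (α i) _ y).symm
    · intro h0
      apply hne
      funext y
      rw [apply_eq_sum_kernel (α j)]
      exact congrFun h0 y
  · rintro ⟨k, hk, hsum, hne⟩
    have hex : ∀ i, ∃ α : (E i → ℚ) →ₗ[ℚ] (E j → ℚ), (∀ f, α f = fun y => ∑ x, k i y x * f x) ∧
        ∀ (g : G) (f : E i → ℚ), α (fun x => f (g⁻¹ • x)) = fun y => α f (g⁻¹ • y) := fun i =>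
      exists_linearMap_of_invariant_kernel (G := G) (k i) (hk i)
    choose α hαk hα using hex
    refine ⟨α, hα, ?_, ?_⟩
    · rw [← hsum]
      funext y
      rw [Finset.sum_apply]
      exact Finset.sum_congr rfl fun i _ => by rw [hαk i]
    · rw [hαk j]
      exact hne

omit [Nonempty I] [∀ i, Nonempty (E i)] in
/-- **PAIRWISE STABILISER BALANCE ⟹ ADDITIVE (families).**  If for all slots `i ≠ j` the type vector `u_1(Φ_i)` sums to
zero over every orbit of `Stab_G(x_j)` on `E_i`, for every `x_j ∈ E_j`, then `U(Σ) = ⊕_i U(Φ_i)` (`Hg(∏ A_i) = ∏ Hg(A_i)`):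
in a relation `Σ_i α_i(u_i) = 0` at slot `j` every `α_i(u_i)`, `i ≠ j`, vanishes (S8), hence so does `α_j(u_j)`.
[cite: Gordon1999HodgeAVSurvey, §3 Theorem (proof)] [cite: Serre1977, §7 Ex. 7.2] -/
theorem forall_map_slotExt_le_of_pairwise_stabilizer_orbit_sums_eq_zero (Φ : ∀ i, Set (E i))
    (hbal : ∀ i j : I, i ≠ j → ∀ (y : E j) (a : E i),
      ∑ x ∈ Finset.univ.filter (fun x : E i => ∃ g : G, g • y = y ∧ g • a = x), antiVec (Φ i) (1 : G) x = 0) :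
    ∀ i, (antiSpan G (Φ i)).map (slotExt i) ≤ antiSpan G (sigmaType Φ) := by
  classical
  refine (forall_map_slotExt_le_iff_forall_not_exists_relation Φ).2 fun j => ?_
  rintro ⟨α, hα, hsum, hne⟩
  apply hne
  have hzero : ∀ i, i ≠ j → α i (antiVec (Φ i) (1 : G)) = 0 := by
    intro i hij
    funext y
    rw [Pi.zero_apply, apply_eq_sum_kernel (α i)]
    refine sum_mul_eq_zero_of_orbit_sums_eq_zero (MulAction.stabilizer G y) _ _ (fun h x => ?_) (fun a => ?_)
    · have h1 := kernel_invariant_of_equivariant (α i) (hα i) (h : G) y x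
      rwa [show (h : G) • y = y from MulAction.mem_stabilizer_iff.1 h.2] at h1
    · have hfil : (Finset.univ.filter fun x : E i => ∃ g : G, g ∈ MulAction.stabilizer G y ∧ g • a = x) =
          Finset.univ.filter fun x : E i => ∃ g : G, g • y = y ∧ g • a = x := by
        simp only [MulAction.mem_stabilizer_iff]
      rw [hfil]
      exact hbal i j hij y a
  rw [← Finset.sum_eq_single j (fun i _ hij => hzero i hij) (fun hj => (hj (Finset.mem_univ j)).elim)]
  exact hsum

/-- **Rank form**: pairwise stabiliser balance ⟹ `rank(Σ) + |I| = Σ_i rank(Φ_i) + 1`.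
[cite: Gordon1999HodgeAVSurvey, §3 Theorem (1) and 7.7] -/
theorem typeRank_sigmaType_add_card_eq_of_pairwise_stabilizer_orbit_sums_eq_zero {ρ : G} {Φ : ∀ i, Set (E i)}
    (h : ∀ i, IsCMTypeWith ρ (Φ i))
    (hbal : ∀ i j : I, i ≠ j → ∀ (y : E j) (a : E i),
      ∑ x ∈ Finset.univ.filter (fun x : E i => ∃ g : G, g • y = y ∧ g • a = x), antiVec (Φ i) (1 : G) x = 0) :
    typeRank G (sigmaType Φ) + Fintype.card I = (∑ i, typeRank G (Φ i)) + 1 :=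
  typeRank_sigmaType_add_card_eq_of_forall_map_le h
    (forall_map_slotExt_le_of_pairwise_stabilizer_orbit_sums_eq_zero Φ hbal)

end IrrOdd

/-! ### §2 Any finite family of CM fields -/

section CM

open CategoryTheory CategoryTheory.Limits NumberField Module IntermediateField
open Literature.NumberTheory.ComplexMultiplication
open Literature.AlgebraicGeometry.Motives (AbelianVariety CMType)
open Literature.AlgebraicGeometry.Motives.AbelianVariety
open Literature.AlgebraicGeometry.HodgeTheory
open Literature.AlgebraicGeometry.ComplexMultiplication (IsCMTypeRealisation)
open Literature.AlgebraicGeometry.Pohlmann1968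

variable {I : Type} [Fintype I] [Nonempty I] {K : I → Type} [∀ i, Field (K i)] [∀ i, NumberField (K i)]
  [∀ i, IsCMField (K i)]

/-- **THE KERNEL-RELATION CRITERION FOR `Hg(∏_i A_i) = ∏_i Hg(A_i)`.**  ANY finite family of CM fields `K_i` with types
`Φ_i` (`u_i = 2·𝟙_{Φ_i} − 1` on `Hom(K_i, ℂ)`): `cmFamilyRank Φ + |I| = Σ_i cmTypeRank Φ_i + 1`
(`dim MT(∏ A_i) − 1 = Σ_i (dim MT(A_i) − 1)`) **iff no slot `j` carries `Aut(ℂ)`-invariant rational kernels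
`k_i : Hom(K_j, ℂ) × Hom(K_i, ℂ) → ℚ` (functions of the `Aut(ℂ)`-orbit of the pair — of the factor of `K_j ⊗ K_i` it
selects) with `Σ_i Σ_{x_i} k_i(·, x_i) u_i(x_i) = 0` and the `j`-th term `Σ_{x} k_j(·, x) u_j(x)` not identically zero.**
[cite: Gordon1999HodgeAVSurvey, §3 Theorem (proof), 7.5–7.7] [cite: Mai1989, §2 Prop. 1 (proof)] [cite: Serre1977, §7 Ex. 7.2] -/
theorem cmFamilyRank_add_card_eq_iff_forall_not_exists_kernel_relation (Φ : ∀ i, CMType (K i)) :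
    CMAlgebra.cmFamilyRank Φ + Fintype.card I = (∑ i, cmTypeRank (Φ i)) + 1 ↔
      ∀ j : I, ¬ ∃ k : ∀ i, (K j →+* ℂ) → (K i →+* ℂ) → ℚ,
        (∀ i (g : ℂ ≃+* ℂ) (y : K j →+* ℂ) (x : K i →+* ℂ), k i (g • y) (g • x) = k i y x) ∧
        (fun y => ∑ i, ∑ x, k i y x * antiVec (Φ i).1 (1 : ℂ ≃+* ℂ) x) = 0 ∧
        (fun y => ∑ x, k j y x * antiVec (Φ j).1 (1 : ℂ ≃+* ℂ) x) ≠ 0 := by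
  haveI : ∀ i, Nonempty (K i →+* ℂ) := fun i => inferInstance
  exact IrrOdd.typeRank_sigmaType_add_card_eq_iff_forall_not_exists_kernel_relation (G := ℂ ≃+* ℂ)
    (E := fun i => K i →+* ℂ) (Φ := fun i => (Φ i).1) (fun i => isCMTypeWith_conj (Φ i))

/-- **PAIRWISE EQUIDISTRIBUTION OVER THE CONJUGATES OF THE OTHER FIELDS ⟹ `Hg(∏_i A_i) = ∏_i Hg(A_i)`.**  ANY CM
fields `K_i`: if for all `i ≠ j` and every embedding `x_j : K_j → ℂ` the type `Φ_i` meets every `Aut(ℂ/x_j(K_j))`-orbit on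
`Hom(K_i, ℂ)` in exactly half of its points, then `cmFamilyRank Φ + |I| = Σ_i cmTypeRank Φ_i + 1`.
[cite: Gordon1999HodgeAVSurvey, §3 Theorem (proof), 7.7 and 9.4.3] [cite: Shimura1998, §8.1 and §8.3] -/
theorem cmFamilyRank_add_card_eq_of_pairwise_stabilizer_orbit_sums_eq_zero (Φ : ∀ i, CMType (K i))
    (hbal : ∀ i j : I, i ≠ j → ∀ (y : K j →+* ℂ) (a : K i →+* ℂ),
      ∑ t ∈ Finset.univ.filter (fun t : K i →+* ℂ => ∃ g : ℂ ≃+* ℂ, g • y = y ∧ g • a = t),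
        antiVec (Φ i).1 (1 : ℂ ≃+* ℂ) t = 0) :
    CMAlgebra.cmFamilyRank Φ + Fintype.card I = (∑ i, cmTypeRank (Φ i)) + 1 := by
  haveI : ∀ i, Nonempty (K i →+* ℂ) := fun i => inferInstance
  exact IrrOdd.typeRank_sigmaType_add_card_eq_of_pairwise_stabilizer_orbit_sums_eq_zero (G := ℂ ≃+* ℂ)
    (E := fun i => K i →+* ℂ) (Φ := fun i => (Φ i).1) (fun i => isCMTypeWith_conj (Φ i)) hbal

omit [Nonempty I] [∀ i, IsCMField (K i)] in
/-- `|⊔_i Hom(K_i, ℂ)| = Σ_i [K_i : ℚ]`. [folklore] -/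
private theorem card_sigma_ringHom_eq_sum_finrank' :
    Fintype.card ((i : I) × (K i →+* ℂ)) = ∑ i, Module.finrank ℚ (K i) := by
  rw [Fintype.card_sigma]
  exact Finset.sum_congr rfl fun i _ => Embeddings.card (K i) ℂ

/-- **The family is NONDEGENERATE (`Hg(∏ A_i)` of maximal rank: `B• = D•` on all products) iff every member is
nondegenerate and no slot carries an invariant-kernel relation.** [cite: Gordon1999HodgeAVSurvey, 7.5–7.6.1 and 9.4] -/
theorem isNondegenerateFamily_iff_forall_isNondegenerate_and_forall_not_exists_kernel_relation (Φ : ∀ i, CMType (K i)) :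
    CMAlgebra.IsNondegenerateFamily Φ ↔ (∀ i, IsNondegenerate (Φ i)) ∧
      ∀ j : I, ¬ ∃ k : ∀ i, (K j →+* ℂ) → (K i →+* ℂ) → ℚ,
        (∀ i (g : ℂ ≃+* ℂ) (y : K j →+* ℂ) (x : K i →+* ℂ), k i (g • y) (g • x) = k i y x) ∧
        (fun y => ∑ i, ∑ x, k i y x * antiVec (Φ i).1 (1 : ℂ ≃+* ℂ) x) = 0 ∧
        (fun y => ∑ x, k j y x * antiVec (Φ j).1 (1 : ℂ ≃+* ℂ) x) ≠ 0 := by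
  rw [← cmFamilyRank_add_card_eq_iff_forall_not_exists_kernel_relation Φ]
  have hle : ∀ i, cmTypeRank (Φ i) ≤ Module.finrank ℚ (K i) / 2 + 1 := fun i => cmTypeRank_le (Φ i)
  have hfam : CMAlgebra.cmFamilyRank Φ + Fintype.card I ≤ (∑ i, cmTypeRank (Φ i)) + 1 := by
    haveI : ∀ i, Nonempty (K i →+* ℂ) := fun i => inferInstance
    exact typeRank_sigmaType_add_card_le (G := ℂ ≃+* ℂ) (E := fun i => K i →+* ℂ) (Φ := fun i => (Φ i).1)
      (fun i => isCMTypeWith_conj (Φ i))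
  have hdiv : (∑ i, Module.finrank ℚ (K i)) / 2 = ∑ i, Module.finrank ℚ (K i) / 2 := by
    rw [← card_sigma_ringHom_eq_sum_finrank' (K := K),
      card_sigma_div_two (G := ℂ ≃+* ℂ) (E := fun i => K i →+* ℂ) (fun i => isCMTypeWith_conj (Φ i))]
    exact Finset.sum_congr rfl fun i _ => by rw [Embeddings.card (K i) ℂ]
  have htot : ∑ j, (Module.finrank ℚ (K j) / 2 + 1) = (∑ j, Module.finrank ℚ (K j) / 2) + Fintype.card I := by
    rw [Finset.sum_add_distrib, Finset.sum_const, Finset.card_univ, smul_eq_mul, mul_one]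
  have hnd : ∀ i, IsNondegenerate (Φ i) ↔ cmTypeRank (Φ i) = Module.finrank ℚ (K i) / 2 + 1 := fun i =>
    isNondegenerate_iff (Φ i)
  have hsumle : ∑ j, cmTypeRank (Φ j) ≤ ∑ j, (Module.finrank ℚ (K j) / 2 + 1) := Finset.sum_le_sum fun j _ => hle j
  rw [CMAlgebra.isNondegenerateFamily_iff, hdiv]
  simp only [hnd]
  constructor
  · intro hS
    have hall : ∀ i, cmTypeRank (Φ i) = Module.finrank ℚ (K i) / 2 + 1 := by
      intro i
      by_contra hne
      have hlt : cmTypeRank (Φ i) < Module.finrank ℚ (K i) / 2 + 1 := lt_of_le_of_ne (hle i) hne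
      have hsum_lt : ∑ j, cmTypeRank (Φ j) < ∑ j, (Module.finrank ℚ (K j) / 2 + 1) :=
        Finset.sum_lt_sum (fun j _ => hle j) ⟨i, Finset.mem_univ i, hlt⟩
      rw [htot] at hsum_lt
      omega
    refine ⟨hall, ?_⟩
    have hsum_eq : ∑ j, cmTypeRank (Φ j) = ∑ j, (Module.finrank ℚ (K j) / 2 + 1) :=
      Finset.sum_congr rfl fun j _ => hall j
    rw [htot] at hsum_eq
    omega
  · rintro ⟨hall, hadd⟩
    have hsum_eq : ∑ j, cmTypeRank (Φ j) = ∑ j, (Module.finrank ℚ (K j) / 2 + 1) :=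
      Finset.sum_congr rfl fun j _ => hall j
    rw [htot] at hsum_eq
    omega

variable {Φ : ∀ i, CMType (K i)} {A : I → AbelianVariety ℂ} {ιA : ∀ i, 𝓞 (K i) →+* End (A i)}
  {θ : ∀ i, K i →+* Module.End ℂ (complexBetti (A i).X 1)}

/-- **Realisations: every Hodge class on every `(∏_{l} A_{π₁ l}) × (∏_{l} A_{π₂ l})` (disjoint slot maps) is a sum of
exterior products ⟺ no slot carries an invariant-kernel relation.** [cite: MoonenZarhin1999LowDim, §3 (3.1)]
[cite: Gordon1999HodgeAVSurvey, 7.5–7.7] -/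
theorem forall_hodgeClassesProductSpan_iff_forall_not_exists_kernel_relation
    (hA : ∀ i, IsCMTypeRealisation (Φ i) (A i) (ιA i) (θ i)) :
    (∀ (N₁ N₂ : ℕ) [NeZero N₁] [NeZero N₂] (π₁ : Fin N₁ → I) (π₂ : Fin N₂ → I), (∀ l₁ l₂, π₁ l₁ ≠ π₂ l₂) →
        HodgeClassesProductSpan (⨁ fun l => A (π₁ l)) (⨁ fun l => A (π₂ l))) ↔
      ∀ j : I, ¬ ∃ k : ∀ i, (K j →+* ℂ) → (K i →+* ℂ) → ℚ,
        (∀ i (g : ℂ ≃+* ℂ) (y : K j →+* ℂ) (x : K i →+* ℂ), k i (g • y) (g • x) = k i y x) ∧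
        (fun y => ∑ i, ∑ x, k i y x * antiVec (Φ i).1 (1 : ℂ ≃+* ℂ) x) = 0 ∧
        (fun y => ∑ x, k j y x * antiVec (Φ j).1 (1 : ℂ ≃+* ℂ) x) ≠ 0 :=
  (cmFamilyRank_add_card_eq_iff_forall_hodgeClassesProductSpan hA).symm.trans
    (cmFamilyRank_add_card_eq_iff_forall_not_exists_kernel_relation Φ)

/-- **THE HODGE CONJECTURE ON EVERY `∏_i A_i^{a_i}`** (every `⨁_{l<N} A_{π l}`) for realisations of NONDEGENERATE types of
arbitrary CM fields with no invariant-kernel relation at any slot — UNCONDITIONALLY (the family is nondegenerate).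
[cite: Gordon1999HodgeAVSurvey, 7.5 and 10.10] -/
theorem hodgeConjectureFor_prod_of_forall_not_exists_kernel_relation (hnd : ∀ i, IsNondegenerate (Φ i))
    (hno : ∀ j : I, ¬ ∃ k : ∀ i, (K j →+* ℂ) → (K i →+* ℂ) → ℚ,
      (∀ i (g : ℂ ≃+* ℂ) (y : K j →+* ℂ) (x : K i →+* ℂ), k i (g • y) (g • x) = k i y x) ∧
      (fun y => ∑ i, ∑ x, k i y x * antiVec (Φ i).1 (1 : ℂ ≃+* ℂ) x) = 0 ∧
      (fun y => ∑ x, k j y x * antiVec (Φ j).1 (1 : ℂ ≃+* ℂ) x) ≠ 0)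
    (hA : ∀ i, IsCMTypeRealisation (Φ i) (A i) (ιA i) (θ i)) {N : ℕ} (π : Fin N → I) :
    HodgeConjectureFor (⨁ fun l : Fin N => A (π l)).dim (⨁ fun l : Fin N => A (π l)).X :=
  ((isNondegenerateFamily_iff_forall_isNondegenerate_and_forall_not_exists_kernel_relation Φ).2
    ⟨hnd, hno⟩).hodgeConjectureFor_prod hA π

end CM

end Summit.HodgeConjecture.CorCM

end
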